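import Mathlib
import HarnessLib
import Summits.RiemannHypothesis.RiemannHypothesis.Theorems.WeilRouteProps.WeilParity
import Summits.RiemannHypothesis.RiemannHypothesis.Theorems.WeilParityEvenWinsBeyondArchStubOnePrimeWindow

/-!
# Theses-free twin of `WeilParityOnePrimeWindowSimpleEven` (build refactor; 21-frontier build rule 2026-08-26T18:52:29Z)
Same declarations as `Theorems/WeilParityOnePrimeWindowSimpleEven.lean`, VERBATIM, in namespace `<old>.Free`, stated against the definitional copies
`…Theorems.WeilRouteProps.<Route>` of the route propositions instead of the route file, so towers / shards can use them
without importing a `Theses` file. The original file is unchanged (keeps the literal route-typed statements for closers).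
Nothing here bears on the truth of RH.
-/

/-! Module docstring of the original: see `Theorems/WeilParityOnePrimeWindowSimpleEven.lean` (content identical). -/

-- single-conjunct summit: the mandated namespace repeats a component (D-0017)
set_option linter.dupNamespace false

namespace Summit.RiemannHypothesis.RiemannHypothesis.Theorems.WeilParity.Free

/-- **Item stmt-RiemannHypothesis-18084** (`OnePrimeWindowSimpleEven`). [cite: ConnesSuijlekom2025, Thm. 6.1 (hypothesis); Yoshida1992, Thm 1 (method); certificate in-tree] -/
theorem onePrimeWindowSimpleEven_proof :
    Summit.RiemannHypothesis.RiemannHypothesis.Theorems.WeilRouteProps.WeilParity.OnePrimeWindowSimpleEven :=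
  Summit.RiemannHypothesis.RiemannHypothesis.Theorems.stub_onePrimeWindowSimpleEven

end Summit.RiemannHypothesis.RiemannHypothesis.Theorems.WeilParity.Free
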